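import Literature.AlgebraicGeometry.Morphisms.CechModuleH2
import Literature.AlgebraicGeometry.Morphisms.CechModuleAffineBasic
import HarnessLib

/-!
# Vanishing of `Ȟ²` of a quasi-coherent module on a principal covering of an affine open

The degree-`2` companion of `Literature/AlgebraicGeometry/Morphisms/CechModuleAffineBasic.lean`
(`cechMZ1_le_cechMB1_basicOpen`, Görtz–Wedhorn I Lemma 12.33 for `p = 1`): for a scheme
`f : X → Spec A`, an affine-localizing (e.g. QUASI-COHERENT) sheaf of `𝒪_X`-modules `M`
(`Literature.AlgebraicGeometry.Modules.IsAffineLocalizing`), an affine open `V ⊆ X` and finitely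
many functions `r_l ∈ Γ(V, 𝒪_X)` generating the unit ideal, every Čech `2`-cocycle of `M` on the
principal covering `(D(r_l))_l` of `V` (full ordered Čech complex, `CechModuleH2`) is a
`2`-coboundary (Görtz–Wedhorn I, Lemma 12.33 for `p = 2` and the `Γ(V, 𝒪_X)`-module `Γ(V, M)`:
the Čech complex of `M~` on a standard covering of `Spec R` is exact in positive degrees;
Hartshorne III Thm. 3.5 / The Stacks Project, Tag 01X8, in Čech form).  The proof is the printed
partition-of-unity computation, run on sections exactly as in degree `1`: with
`Γ(D(r), M) = Γ(V, M)_r` write `e_{lmn} = x_{lmn} / (r_l r_m r_n)^K`, `x_{lmn} ∈ Γ(V, M)`; the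
cocycle identity on `D(r_j r_l r_m r_n)` gives
`r_j^N (r_j^K x_{lmn} - r_l^K x_{jmn} + r_m^K x_{jln} - r_n^K x_{jlm}) = 0` in `Γ(D(r_l r_m r_n), M)`;
with `Σ_j a_j r_j^{K+N} = 1`, `c_{mn} = (r_m r_n)^{-K} Σ_j a_j r_j^N x_{jmn}` has `d¹ c = e`
(the module identity is `cech_partition_identity_smul₂`).

* `cech_partition_identity_smul₂` — the identity of Görtz–Wedhorn I, Lemma 12.33 (`p = 2`), in a
  module;
* `cechMZ2_le_cechMB2_basicOpen` — **the theorem**.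

The case of a family of affine opens covering `V` (refine by principal opens and transfer through
the double complex of the two families) is in `Morphisms/CechModuleH2CoverIndependence`. Everything is
proved; no named facts. Mathlib searched (pin v4.32): `IsAffineOpen.basicOpen`,
`Scheme.basicOpen_mul`, `Scheme.basicOpen_res`, `Ideal.span_pow_eq_top`,
`RingedSpace.isUnit_res_basicOpen`, the `module` / `linear_combination` tactics (used).

## References

* U. Görtz, T. Wedhorn, *Algebraic Geometry I: Schemes*, 2nd ed. (2020): Prop. 12.32 and
  Lemma 12.33 with (12.8.1), p. 421. [GortzWedhorn2020]
* R. Hartshorne, *Algebraic Geometry*, GTM 52 (1977): II Lemma 5.3 (p. 112), III Thm. 3.5,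
  III Thm. 4.5 (p. 222). [Hartshorne1977]
* The Stacks Project, Tag 01X8 (Čech cohomology of quasi-coherent sheaves), Tag 01X9.
  [StacksProject]
-/

noncomputable section

open CategoryTheory AlgebraicGeometry Limits TopologicalSpace Opposite

universe u v

namespace Literature.AlgebraicGeometry.Morphisms

/-! ## The module identity behind Lemma 12.33 (`p = 2`) -/

/-- The partition-of-unity identity of Görtz–Wedhorn I, Lemma 12.33 (`p = 2`), in a module `N`
over a commutative ring `R`: if `α_l p_l = α_m p_m = α_n p_n = 1`, `Σ_j a_j t_j^{K+N} = 1`,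
`t_j^N • (t_j^K • Z - p_l^K • X_j + p_m^K • Y_j - p_n^K • W_j) = 0` for all `j` and
`Z = (p_l p_m p_n)^K • e`, then
`e = (α_m α_n)^K • Σ_j (a_j t_j^N) • X_j - (α_l α_n)^K • Σ_j (a_j t_j^N) • Y_j
  + (α_l α_m)^K • Σ_j (a_j t_j^N) • W_j`.
[cite: GortzWedhorn2020, Lemma 12.33 proof (p. 421)] -/
theorem cech_partition_identity_smul₂ {R : Type*} [CommRing R] {N : Type*} [AddCommGroup N]
    [Module R N] {L : Type*} [Fintype L] (K N₀ : ℕ) (αl αm αn pl pm pn : R) (Z e : N)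
    (t a : L → R) (Xj Yj Wj : L → N) (hαl : αl * pl = 1) (hαm : αm * pm = 1)
    (hαn : αn * pn = 1) (hsum : ∑ j, a j * t j ^ (K + N₀) = 1)
    (htors : ∀ j, t j ^ N₀ • (t j ^ K • Z - pl ^ K • Xj j + pm ^ K • Yj j - pn ^ K • Wj j) = 0)
    (hZ : Z = (pl * pm * pn) ^ K • e) :
    e = ((αm * αn) ^ K • ∑ j, (a j * t j ^ N₀) • Xj j) -
      ((αl * αn) ^ K • ∑ j, (a j * t j ^ N₀) • Yj j) +
        ((αl * αm) ^ K • ∑ j, (a j * t j ^ N₀) • Wj j) := by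
  have el : (αl * pl) ^ K = 1 := by rw [hαl, one_pow]
  have em : (αm * pm) ^ K = 1 := by rw [hαm, one_pow]
  have en : (αn * pn) ^ K = 1 := by rw [hαn, one_pow]
  have hj : ∀ j, (a j * t j ^ (K + N₀)) • Z =
      (a j * t j ^ N₀ * pl ^ K) • Xj j - (a j * t j ^ N₀ * pm ^ K) • Yj j +
        (a j * t j ^ N₀ * pn ^ K) • Wj j := by
    intro j
    have h := congrArg (fun v => a j • v) (htors j)
    simp only [smul_zero] at h
    rw [← sub_eq_zero, ← h, pow_add]
    module
  have hZ' : Z = ∑ j, ((a j * t j ^ N₀ * pl ^ K) • Xj j - (a j * t j ^ N₀ * pm ^ K) • Yj j +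
      (a j * t j ^ N₀ * pn ^ K) • Wj j) := by
    calc Z = (∑ j, a j * t j ^ (K + N₀)) • Z := by rw [hsum, one_smul]
      _ = ∑ j, (a j * t j ^ (K + N₀)) • Z := Finset.sum_smul
      _ = _ := Finset.sum_congr rfl fun j _ => hj j
  have he : e = (αl * αm * αn) ^ K • Z := by
    rw [hZ, smul_smul, ← mul_pow,
      show αl * αm * αn * (pl * pm * pn) = (αl * pl) * (αm * pm) * (αn * pn) by ring, mul_pow,
      mul_pow, el, em, en, one_mul, one_mul, one_smul]
  rw [he, hZ', Finset.smul_sum, Finset.smul_sum, Finset.smul_sum, Finset.smul_sum,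
    ← Finset.sum_sub_distrib, ← Finset.sum_add_distrib]
  refine Finset.sum_congr rfl fun j _ => ?_
  have s1 : (αl * αm * αn) ^ K * (a j * t j ^ N₀ * pl ^ K) = (αm * αn) ^ K * (a j * t j ^ N₀) := by
    linear_combination ((αm * αn) ^ K * (a j * t j ^ N₀)) * el
  have s2 : (αl * αm * αn) ^ K * (a j * t j ^ N₀ * pm ^ K) = (αl * αn) ^ K * (a j * t j ^ N₀) := by
    linear_combination ((αl * αn) ^ K * (a j * t j ^ N₀)) * em
  have s3 : (αl * αm * αn) ^ K * (a j * t j ^ N₀ * pn ^ K) = (αl * αm) ^ K * (a j * t j ^ N₀) := by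
    linear_combination ((αl * αm) ^ K * (a j * t j ^ N₀)) * en
  rw [smul_add, smul_sub, smul_smul, smul_smul, smul_smul, smul_smul, smul_smul, smul_smul, s1, s2,
    s3]

variable {A : Type u} [CommRing A] {X : Scheme.{u}} (f : X ⟶ Spec (.of A)) {M : X.Modules}

/-- The `2`-cocycle identity restricted to an open `W ⊆ U_i ∩ U_j ∩ U_k ∩ U_l` (local copy of
`cechMZ2.cocycle_res` of `CechModuleH2RefinementLemmas`, kept private so that this file does not
depend on that one). [folklore] -/
private theorem cocycle_res₂ {ι : Type v} (U : ι → X.Opens) {e : CechMC2 f M U}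
    (he : e ∈ cechMZ2 f M U) (i j k l : ι) {W : X.Opens} (hi : W ≤ U i) (hj : W ≤ U j)
    (hk : W ≤ U k) (hl : W ≤ U l) :
    MSections.res f M (le_inf (le_inf hj hk) hl) (e j k l) -
        MSections.res f M (le_inf (le_inf hi hk) hl) (e i k l) +
          MSections.res f M (le_inf (le_inf hi hj) hl) (e i j l) -
            MSections.res f M (le_inf (le_inf hi hj) hk) (e i j k) = 0 := by
  have h0 : cechMD2 f M U e i j k l = 0 := by
    rw [(mem_cechMZ2_iff f M U e).mp he]; rfl
  have h1 := congrArg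
    (MSections.res f M (le_inf (le_inf (le_inf hi hj) hk) hl : W ≤ U i ⊓ U j ⊓ U k ⊓ U l)) h0
  rw [cechMD2_apply, map_sub, map_add, map_sub, map_zero, MSections.res_res, MSections.res_res,
    MSections.res_res, MSections.res_res] at h1
  exact h1

/-! ## Lemma 12.33 for `p = 2`: principal coverings of an affine open -/

section StandardCover

variable (hM : Literature.AlgebraicGeometry.Modules.IsAffineLocalizing M) {V : X.Opens}
  (hV : IsAffineOpen V) {L : Type v} (r : L → Sections f V)

include hM hV in
/-- **Görtz–Wedhorn I, Lemma 12.33 (`p = 2`) for the `Γ(V, 𝒪)`-module `Γ(V, M)`**: for an affine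
open `V`, an affine-localizing (e.g. quasi-coherent) `M` and finitely many `r_l ∈ Γ(V, 𝒪)`
generating the unit ideal, every Čech `2`-cocycle of `M` on the principal covering `(D(r_l))_l` of
`V` is a `2`-coboundary. [cite: GortzWedhorn2020, Lemma 12.33 (p. 421)] -/
theorem cechMZ2_le_cechMB2_basicOpen [Fintype L] (hr : Ideal.span (Set.range r) = ⊤) :
    cechMZ2 f M (fun l => X.basicOpen (r l)) ≤ cechMB2 f M (fun l => X.basicOpen (r l)) := by
  classical
  intro e he
  have h3V : ∀ l m n, X.basicOpen (r l) ⊓ X.basicOpen (r m) ⊓ X.basicOpen (r n) ≤ V :=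
    fun l m n => (inf_le_left.trans inf_le_left).trans (X.basicOpen_le (r l))
  have h3eq : ∀ l m n, X.basicOpen (r l) ⊓ X.basicOpen (r m) ⊓ X.basicOpen (r n) =
      X.basicOpen (r l * r m * r n) := fun l m n =>
    ((X.basicOpen_mul (r l * r m) (r n)).trans
      (congrArg (· ⊓ X.basicOpen (r n)) (X.basicOpen_mul (r l) (r m)))).symm
  -- (1) numerators with a uniform exponent `K`: `x_{lmn}|_{D_lmn} = (r_l r_m r_n)^K • e_{lmn}`
  have hnum : ∀ l m n, ∃ (k : ℕ) (x : MSections f M V), MSections.res f M (h3V l m n) x =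
      Sections.res f (h3V l m n) (r l * r m * r n) ^ k • e l m n :=
    fun l m n => MSections.exists_res_eq_pow_smul f hM hV (r l * r m * r n) (h3eq l m n) (e l m n)
  choose k x hx using hnum
  obtain ⟨K, hK⟩ : ∃ K, ∀ l m n, k l m n ≤ K :=
    ⟨Finset.univ.sup fun p : L × L × L => k p.1 p.2.1 p.2.2, fun l m n =>
      Finset.le_sup (f := fun p : L × L × L => k p.1 p.2.1 p.2.2) (Finset.mem_univ (l, m, n))⟩
  set x' : L → L → L → MSections f M V := fun l m n => (r l * r m * r n) ^ (K - k l m n) • x l m n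
    with hx'def
  have hx' : ∀ l m n, MSections.res f M (h3V l m n) (x' l m n) =
      Sections.res f (h3V l m n) (r l * r m * r n) ^ K • e l m n := by
    intro l m n
    simp only [hx'def, MSections.res_smul, map_pow, hx l m n, smul_smul, pow_sub_mul_pow _ (hK l m n)]
  -- (2) torsion from the cocycle identity, uniform exponent `N`:
  --     `r_j^N • (r_j^K • x_{lmn} - r_l^K • x_{jmn} + r_m^K • x_{jln} - r_n^K • x_{jlm}) = 0` on `D_lmn`
  have htors : ∀ j l m n, ∃ N : ℕ, Sections.res f (h3V l m n) (r j) ^ N •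
      MSections.res f M (h3V l m n)
        (r j ^ K • x' l m n - r l ^ K • x' j m n + r m ^ K • x' j l n - r n ^ K • x' j l m) = 0 := by
    intro j l m n
    have haff : IsAffineOpen (X.basicOpen (r l) ⊓ X.basicOpen (r m) ⊓ X.basicOpen (r n)) := by
      rw [h3eq]; exact hV.basicOpen _
    have hQ : X.basicOpen (r j) ⊓ X.basicOpen (r l) ⊓ X.basicOpen (r m) ⊓ X.basicOpen (r n) ≤
        X.basicOpen (r l) ⊓ X.basicOpen (r m) ⊓ X.basicOpen (r n) :=
      le_inf (le_inf ((inf_le_left.trans inf_le_left).trans inf_le_right)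
        (inf_le_left.trans inf_le_right)) inf_le_right
    have hgQ : X.basicOpen (Sections.res f (h3V l m n) (r j)) ≤
        X.basicOpen (r j) ⊓ X.basicOpen (r l) ⊓ X.basicOpen (r m) ⊓ X.basicOpen (r n) := by
      rw [Sections.res_apply, Scheme.basicOpen_res]
      exact le_inf (le_inf (le_inf inf_le_right ((inf_le_left.trans inf_le_left).trans inf_le_left))
        ((inf_le_left.trans inf_le_left).trans inf_le_right)) (inf_le_left.trans inf_le_right)
    refine MSections.exists_pow_smul_eq_zero f hM haff (Sections.res f (h3V l m n) (r j)) _ hQ hgQ ?_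
    have hcoc := cocycle_res₂ f (fun l => X.basicOpen (r l)) he j l m n
      ((inf_le_left.trans inf_le_left).trans inf_le_left :
        X.basicOpen (r j) ⊓ X.basicOpen (r l) ⊓ X.basicOpen (r m) ⊓ X.basicOpen (r n) ≤ _)
      ((inf_le_left.trans inf_le_left).trans inf_le_right) (inf_le_left.trans inf_le_right)
      inf_le_right
    have exlmn := congrArg (MSections.res f M hQ) (hx' l m n)
    have exjmn := congrArg (MSections.res f M
      (le_inf (le_inf ((inf_le_left.trans inf_le_left).trans inf_le_left)
        (inf_le_left.trans inf_le_right)) inf_le_right :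
        X.basicOpen (r j) ⊓ X.basicOpen (r l) ⊓ X.basicOpen (r m) ⊓ X.basicOpen (r n) ≤
          X.basicOpen (r j) ⊓ X.basicOpen (r m) ⊓ X.basicOpen (r n))) (hx' j m n)
    have exjln := congrArg (MSections.res f M
      (le_inf (le_inf ((inf_le_left.trans inf_le_left).trans inf_le_left)
        ((inf_le_left.trans inf_le_left).trans inf_le_right)) inf_le_right :
        X.basicOpen (r j) ⊓ X.basicOpen (r l) ⊓ X.basicOpen (r m) ⊓ X.basicOpen (r n) ≤
          X.basicOpen (r j) ⊓ X.basicOpen (r l) ⊓ X.basicOpen (r n))) (hx' j l n)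
    have exjlm := congrArg (MSections.res f M
      (le_inf (le_inf ((inf_le_left.trans inf_le_left).trans inf_le_left)
        ((inf_le_left.trans inf_le_left).trans inf_le_right)) (inf_le_left.trans inf_le_right) :
        X.basicOpen (r j) ⊓ X.basicOpen (r l) ⊓ X.basicOpen (r m) ⊓ X.basicOpen (r n) ≤
          X.basicOpen (r j) ⊓ X.basicOpen (r l) ⊓ X.basicOpen (r m))) (hx' j l m)
    simp only [MSections.res_smul, map_pow, map_mul, MSections.res_res, Sections.res_res]
      at exlmn exjmn exjln exjlm
    simp only [map_add, map_sub, MSections.res_smul, map_pow, MSections.res_res, Sections.res_res]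
    rw [exlmn, exjmn, exjln, exjlm]
    -- the cocycle identity times `(r_j r_l r_m r_n)^K`
    set Q := X.basicOpen (r j) ⊓ X.basicOpen (r l) ⊓ X.basicOpen (r m) ⊓ X.basicOpen (r n)
    set ρj := Sections.res f (hQ.trans (h3V l m n)) (r j)
    set ρl := Sections.res f (hQ.trans (h3V l m n)) (r l)
    set ρm := Sections.res f (hQ.trans (h3V l m n)) (r m)
    set ρn := Sections.res f (hQ.trans (h3V l m n)) (r n)
    have key := congrArg (fun v => (ρj * ρl * ρm * ρn) ^ K • v) hcoc
    simp only [smul_zero] at key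
    rw [← key]
    module
  choose N hN using htors
  obtain ⟨N₀, hN₀⟩ : ∃ N₀, ∀ j l m n, N j l m n ≤ N₀ :=
    ⟨Finset.univ.sup fun p : L × L × L × L => N p.1 p.2.1 p.2.2.1 p.2.2.2, fun j l m n =>
      Finset.le_sup (f := fun p : L × L × L × L => N p.1 p.2.1 p.2.2.1 p.2.2.2)
        (Finset.mem_univ (j, l, m, n))⟩
  have hN' : ∀ j l m n, Sections.res f (h3V l m n) (r j) ^ N₀ •
      (Sections.res f (h3V l m n) (r j) ^ K • MSections.res f M (h3V l m n) (x' l m n) -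
        Sections.res f (h3V l m n) (r l) ^ K • MSections.res f M (h3V l m n) (x' j m n) +
        Sections.res f (h3V l m n) (r m) ^ K • MSections.res f M (h3V l m n) (x' j l n) -
        Sections.res f (h3V l m n) (r n) ^ K • MSections.res f M (h3V l m n) (x' j l m)) = 0 := by
    intro j l m n
    have h := hN j l m n
    simp only [map_add, map_sub, MSections.res_smul, map_pow] at h
    have eN : N₀ = (N₀ - N j l m n) + N j l m n := (Nat.sub_add_cancel (hN₀ j l m n)).symm
    rw [eN, pow_add, mul_smul, h, smul_zero]
  -- (3) partition of unity `Σ_j a_j r_j^{K+N₀} = 1`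
  obtain ⟨a, ha⟩ : ∃ a : L → Sections f V, ∑ j, a j * r j ^ (K + N₀) = 1 := by
    have h1 := Ideal.span_pow_eq_top (Set.range r) hr (K + N₀)
    rw [← Set.range_comp, Ideal.eq_top_iff_one] at h1
    exact Ideal.mem_span_range_iff_exists_fun.mp h1
  -- (4) the cochain `c_{mn} = (r_m r_n)^{-K} Σ_j a_j r_j^{N₀} x_{jmn}` on `D_mn`
  have h2V : ∀ m n, X.basicOpen (r m) ⊓ X.basicOpen (r n) ≤ V :=
    fun m n => inf_le_left.trans (X.basicOpen_le (r m))
  have hunit : ∀ l, ∃ ul : Sections f (X.basicOpen (r l)),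
      ul * Sections.res f (X.basicOpen_le (r l)) (r l) = 1 :=
    fun l => ⟨_, (X.toRingedSpace.isUnit_res_basicOpen (r l)).val_inv_mul⟩
  choose u hu using hunit
  set c : CechMC1 f M (fun l => X.basicOpen (r l)) := fun m n =>
    (Sections.res f inf_le_left (u m) * Sections.res f inf_le_right (u n)) ^ K •
      ∑ j, MSections.res f M (h2V m n) ((a j * r j ^ N₀) • x' j m n) with hc
  refine (mem_cechMB2_iff f M _ e).mpr ⟨c, ?_⟩
  funext l m n
  rw [cechMD1_apply]
  simp only [hc, MSections.res_smul, map_pow, map_mul, map_sum, MSections.res_res, Sections.res_res]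
  -- (5) the module identity on `D_lmn`
  have hul : Sections.res f (inf_le_left.trans inf_le_left : X.basicOpen (r l) ⊓
        X.basicOpen (r m) ⊓ X.basicOpen (r n) ≤ X.basicOpen (r l)) (u l) *
      Sections.res f (h3V l m n) (r l) = 1 := by
    rw [← Sections.res_res f (X.basicOpen_le (r l))
      (inf_le_left.trans inf_le_left : X.basicOpen (r l) ⊓ X.basicOpen (r m) ⊓ X.basicOpen (r n) ≤ _),
      ← map_mul, hu l, map_one]
  have hum : Sections.res f (inf_le_left.trans inf_le_right : X.basicOpen (r l) ⊓
        X.basicOpen (r m) ⊓ X.basicOpen (r n) ≤ X.basicOpen (r m)) (u m) *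
      Sections.res f (h3V l m n) (r m) = 1 := by
    rw [← Sections.res_res f (X.basicOpen_le (r m))
      (inf_le_left.trans inf_le_right : X.basicOpen (r l) ⊓ X.basicOpen (r m) ⊓ X.basicOpen (r n) ≤ _),
      ← map_mul, hu m, map_one]
  have hun : Sections.res f (inf_le_right : X.basicOpen (r l) ⊓
        X.basicOpen (r m) ⊓ X.basicOpen (r n) ≤ X.basicOpen (r n)) (u n) *
      Sections.res f (h3V l m n) (r n) = 1 := by
    rw [← Sections.res_res f (X.basicOpen_le (r n))
      (inf_le_right : X.basicOpen (r l) ⊓ X.basicOpen (r m) ⊓ X.basicOpen (r n) ≤ _),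
      ← map_mul, hu n, map_one]
  have key := cech_partition_identity_smul₂
    (R := Sections f (X.basicOpen (r l) ⊓ X.basicOpen (r m) ⊓ X.basicOpen (r n))) K N₀
    (Sections.res f (inf_le_left.trans inf_le_left) (u l))
    (Sections.res f (inf_le_left.trans inf_le_right) (u m))
    (Sections.res f inf_le_right (u n))
    (Sections.res f (h3V l m n) (r l)) (Sections.res f (h3V l m n) (r m))
    (Sections.res f (h3V l m n) (r n))
    (MSections.res f M (h3V l m n) (x' l m n)) (e l m n)
    (fun j => Sections.res f (h3V l m n) (r j)) (fun j => Sections.res f (h3V l m n) (a j))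
    (fun j => MSections.res f M (h3V l m n) (x' j m n))
    (fun j => MSections.res f M (h3V l m n) (x' j l n))
    (fun j => MSections.res f M (h3V l m n) (x' j l m))
    hul hum hun
    (by
      have := congrArg (Sections.res f (h3V l m n)) ha
      simpa only [map_sum, map_mul, map_pow, map_one] using this)
    (hN' · l m n)
    (by rw [hx' l m n, map_mul, map_mul])
  rw [key]

end StandardCover

end Literature.AlgebraicGeometry.Morphisms

end
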